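import Summits.CriticalPhenomena.CardyFormulaZ2.Theorems.CardyIKTransportIKMixedBoxCrossingXorDefs
import Summits.CriticalPhenomena.CardyFormulaZ2.Theorems.CardyIKTransportIKMixedBoxCrossingXorStubDichotomy
import Summits.CriticalPhenomena.CardyFormulaZ2.Theorems.CardyIKTransportIKMixedBoxCrossingDefs
import Summits.CriticalPhenomena.CardyFormulaZ2.Theorems.CardyIKTransportIKMixedBoxCrossingStubPatternLocality
import Summits.CriticalPhenomena.CardyFormulaZ2.Theorems.CardyIKTransportIKMixedBoxCrossingStubDuality
import Summits.CriticalPhenomena.CardyFormulaZ2.Theorems.CardyIKTransportIKMixedBoxCrossingStubQuarterTurn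

/-!
# Helper `isotropyFloor_univ` toward `stub_isotropyFloor` (line `xor-rectangle-flip`, crux
# `IKMixedBoxCrossing`, stmt-CriticalPhenomena-5911)

Support file (`--supports stmt-CriticalPhenomena-5911`): the PURE-ISOTROPIC member (`S = univ`) of the
isotropy floor `IsotropyFloor` of the line — squares of every side `n ≥ 1` at every position are crossed
by black paths in both directions with probability `≥ 1/2`:

  `isotropyFloor_univ : ∃ m > 0, ∀ n ≥ 1, ∀ a b, m ≤ μIK.real (bLR univ a b n n) ∧ m ≤ μIK.real (bTB univ a b n n)`.

Proof (`m = 1/2`).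
* BRIDGE (definitional): the crux's black crossing events `bLR`/`bTB` of `XorDefs` (over the `Negative.*`
  gauge) have the crossing probabilities `pLR`/`pTB` of the sibling line `paired-mirror-exploration`
  (over the `PinnedDiagramExchange.*` copy of the same gauge): both copies of `μIK`, `blackSet`,
  `antiSet` are the same terms and `cellEdges B D = blackEdges (B, D)` verbatim, so
  `μIK.real (bLR S a b w h) = pLR S a b w h` is `rfl` (`real_bLR_eq_pLR`, `real_bTB_eq_pTB`).
* `n ≥ 2`: the EXACT square value `pLR univ 0 0 n n = pTB univ 0 0 n n = 1/2` of the isotropic model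
  (`pLR_square_univ`/`pTB_square_univ` of the Defs file from the LANDED stubs `stub_patternLocality`,
  `stub_duality`, `stub_quarterTurn`), recentred to `(a, b)` by `univ_recentre stub_patternLocality`.
* `n = 1`: in the bond reading the two sides of the `1 × 1` box meet, so every configuration crosses it
  (`DichotomyStub.mem_lrCross_one`, `mem_tbCross_one`): the events are `univ`, of probability `1 ≥ 1/2`.
-/

open MeasureTheory
open Literature.Probability.Percolation Literature.Probability.LatticeModels
open Summit.CriticalPhenomena.CardyFormulaZ2.Theorems.IKMixedBoxCrossing.Negative (Ω μIK blackSet antiSet edges)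
open Summit.CriticalPhenomena.CardyFormulaZ2.Cruxes.IKMixedBoxCrossing.PairedMirrorExploration
  (pLR pTB stub_patternLocality stub_duality stub_quarterTurn pLR_square_univ pTB_square_univ univ_recentre)

noncomputable section

namespace Summit.CriticalPhenomena.CardyFormulaZ2.Cruxes.IKMixedBoxCrossing.XorRectangleFlip

namespace IsoUnivStub

/-! ## §1 The definitional bridge `bLR`/`bTB` ↔ `pLR`/`pTB` -/

/-- BRIDGE: the probability of the crux's black left–right crossing event of the `w × h` box at `(a, b)`
is the sibling line's `pLR` (same gauge, same bond encoding — definitional). -/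
theorem real_bLR_eq_pLR (S : Set ℤ) (a b : ℤ) (w h : ℕ) : μIK.real (bLR S a b w h) = pLR S a b w h :=
  rfl

/-- BRIDGE: the probability of the crux's black bottom–top crossing event of the `w × h` box at `(a, b)`
is the sibling line's `pTB` (definitional). -/
theorem real_bTB_eq_pTB (S : Set ℤ) (a b : ℤ) (w h : ℕ) : μIK.real (bTB S a b w h) = pTB S a b w h :=
  rfl

/-! ## §2 The `1 × 1` box is crossed surely -/

/-- Every configuration crosses the `1 × 1` box from left to right (its two columns coincide). -/
theorem bLR_one_one (S : Set ℤ) (a b : ℤ) : bLR S a b 1 1 = Set.univ :=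
  Set.eq_univ_of_forall fun ω => DichotomyStub.mem_lrCross_one a b 1 le_rfl (edges S ω)

/-- Every configuration crosses the `1 × 1` box from bottom to top (its two rows coincide). -/
theorem bTB_one_one (S : Set ℤ) (a b : ℤ) : bTB S a b 1 1 = Set.univ :=
  Set.eq_univ_of_forall fun ω => DichotomyStub.mem_tbCross_one a b 1 le_rfl (edges S ω)

/-- Hence the `1 × 1` left–right crossing has probability `1`. -/
theorem real_bLR_one_one (S : Set ℤ) (a b : ℤ) : μIK.real (bLR S a b 1 1) = 1 := by
  rw [bLR_one_one, probReal_univ]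

/-- Hence the `1 × 1` bottom–top crossing has probability `1`. -/
theorem real_bTB_one_one (S : Set ℤ) (a b : ℤ) : μIK.real (bTB S a b 1 1) = 1 := by
  rw [bTB_one_one, probReal_univ]

/-! ## §3 Squares of side `≥ 2` of the isotropic model: exactly `1/2` -/

/-- `P_univ[LR(n × n at (a, b))] = 1/2` for `n ≥ 2` (duality + quarter turn + pattern locality, all landed). -/
theorem real_bLR_univ_square (a b : ℤ) {n : ℕ} (hn : 2 ≤ n) : μIK.real (bLR Set.univ a b n n) = 1 / 2 := by
  rw [real_bLR_eq_pLR, (univ_recentre stub_patternLocality a b n n).1,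
    pLR_square_univ stub_patternLocality stub_duality stub_quarterTurn hn]

/-- `P_univ[TB(n × n at (a, b))] = 1/2` for `n ≥ 2`. -/
theorem real_bTB_univ_square (a b : ℤ) {n : ℕ} (hn : 2 ≤ n) : μIK.real (bTB Set.univ a b n n) = 1 / 2 := by
  rw [real_bTB_eq_pTB, (univ_recentre stub_patternLocality a b n n).2,
    pTB_square_univ stub_patternLocality stub_duality stub_quarterTurn hn]

end IsoUnivStub

open IsoUnivStub in
/-- **Helper `isotropyFloor_univ`** (registered sub-goal toward `stub_isotropyFloor`, line
`xor-rectangle-flip`): the `S = univ` member of the isotropy floor — squares of every side `n ≥ 1` at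
every position are crossed by black paths in BOTH directions with probability `≥ 1/2` (exactly `1/2`
for `n ≥ 2` by self-duality and the quarter-turn symmetry of the isotropic gauge; `1` for `n = 1`). -/
theorem isotropyFloor_univ : ∃ m : ℝ, 0 < m ∧ ∀ n : ℕ, 1 ≤ n → ∀ a b : ℤ,
    m ≤ μIK.real (bLR Set.univ a b n n) ∧ m ≤ μIK.real (bTB Set.univ a b n n) := by
  refine ⟨1 / 2, by norm_num, fun n hn a b => ?_⟩
  rcases Nat.lt_or_ge n 2 with hlt | hge
  · obtain rfl : n = 1 := by omega
    rw [Nat.cast_one, real_bLR_one_one, real_bTB_one_one]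
    norm_num
  · rw [real_bLR_univ_square a b hge, real_bTB_univ_square a b hge]
    exact ⟨le_rfl, le_rfl⟩

end Summit.CriticalPhenomena.CardyFormulaZ2.Cruxes.IKMixedBoxCrossing.XorRectangleFlip

end
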